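import Literature.MathematicalPhysics.QuantumFieldTheory.Balaban1983to89.B4Lower18

/-!
# NE7K1LinWalkCommutator — row NE7 (node U5), candidate route HOM, path H1L, cell K1-lin(s): B4 LEMMA 2.1's L²-CONTENT AT `A = 0` —
# THE CUT-OFF COMMUTATOR OF `lap c + Σ_b m_b 1_b ⊗ 1_b` (the shape of `−Δ^η + aQ*Q`) IS FORM-BOUNDED,
# `‖[diag(l), H]v‖² ≤ α²⟨v,Hv⟩ + β²‖v‖²`, WITH `α², β²` READ OFF THREE NUMBERS OF THE CUT-OFF; then Bałaban's `fineOpR`, mesh-free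

Lineage `b2b-balaban-t4-ne7-p2` (CRUX PROVER NE7 #2), generation 68; series (RW) file 4 (independent of files 1–3: the commutator is
written out as `diagonal l * H − H * diagonal l`).  [Balaban1983RegularityDecay] = T. Bałaban, Commun. Math. Phys. 89 (1983) 571–597:
p. 575 (2.3) *"(D^η_{A,μ}(hφ))(x) = h(x)(D^η_{A,μ}φ)(x) + (D^η_μh)(x)U(A_{⟨x,x+ηe_μ⟩})φ(x + ηe_μ)"* (the lattice Leibniz rule behind
`K_j = [−Δ^η_A + aQ*Q, h_j]`) and Lemma 2.1 (2.15) p. 577 (L²-bounds of `G_k(□)`, `∇G_k(□)`, …, `O(1)` uniformly in `η`).  What the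
random-walk smallness (file 2's hypothesis (H-comm)) needs from them is ONE inequality, proved here [folklore]:

* **`comm_mulVec_sq_le_lap_add_blocks`** — for `H_{jk} = lap c_{jk} + Σ_b m_b 1_b(j)1_b(k)` (symmetric `c ≥ 0`, block labels `blk`,
  strengths `m_b ≥ 0` with `m_{blk k}·|block of k| ≤ a′`) and a cut-off `l` with (A) `Σ_k c_{jk}(l_j − l_k)² ≤ A` for every `j`
  (weighted Lipschitz², B4's `|∇h|² = O(M^{−2})`), (B) `|Σ_k c_{jk}(l_j − l_k)| ≤ B` for every `j` (the operator applied to the cut-off,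
  B4's `|Δh| = O(M^{−2})` — on a region this is the NEUMANN-COMPATIBLE second difference), (δ) `|l_j − l_k| ≤ δ` inside blocks:
  `‖[diag(l),H]v‖² ≤ 6A·⟨v,Hv⟩ + 3(B² + a′²δ²)·‖v‖²`.  Mechanism = (2.3): `([l,H]v)_j = −Σ_k c_{jk}(l_j−l_k)(v_k−v_j) − v_j·Σ_k c_{jk}(l_j−l_k)
  + m_{b(j)}Σ_{k∈b(j)}(l_j−l_k)v_k` — the first term is carried by the DIRICHLET FORM of `v` (weighted Cauchy–Schwarz), the second by
  `B`, the third by `a′δ` (Cauchy–Schwarz on the block and `m_b|b| ≤ a′`).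
* **`comm_mulVec_sq_le_fineOpR`** — the instance `H = fineOpR n a 0 R` (`= n²(−Δ^N_R) + (a∕n^{d+1})1_{same n-block}`, B4 (1.6) at
  A = 0 in lattice units, `B4Lower18`) on a union `R` of `n`-blocks, for a cut-off with `|l_x − l_y| ≤ ℓ₁` across bonds,
  `|Σ_{y ∼ x, y ∈ R}(l_x − l_y)| ≤ ℓ₂` at every site and `|l_x − l_y| ≤ ℓ₃` inside `n`-blocks:
  `‖[diag(l), fineOpR]v‖² ≤ 12(d+1)n²ℓ₁²·⟨v, fineOpR v⟩ + 3((n²ℓ₂)² + a²ℓ₃²)·‖v‖²` — with `ℓ₁ = O(1∕(Mn))`, `ℓ₂ = O(1∕(Mn)²)`, `ℓ₃ = O(1∕M)`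
  for a cut-off varying on the scale of `M` blocks (file 5), BOTH CONSTANTS ARE FREE OF THE MESH `1∕n`: Lemma 2.1's uniformity in `η`.

HONEST FRAMING: [folklore] finite sums; B4's (2.3)∕(2.15) quoted as the dictionary; A = 0 only (no covariant derivative, no gauge
field), one lattice; nothing of Bałaban's asserted; no `sorry`.  Census only; NO letter ∕ tag ∕ size of NE7 moves; NE7 NOT PRINTED ∕ NOT
PROVED; spine 0∕9; FIXED FINITE T⁴, rung (B)+1; NOT infinite volume, NOT mass gap, NOT Clay.  HONEST DEPENDENCY: continuum YM on T⁴ ⇐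
BetaPertH ∧ nine spine estimates (0/9 proved); BetaPertH ⇐ (D1) ∧ (D4) ∧ CAP+tail; G-an2-4 gates asym, D1 and NE2/3/4.
-/

noncomputable section

open Finset Matrix

namespace Summit.QuantumFields.BalabanUV.T4Continuum.NE7K1LinWalkCommutator

open Literature.MathematicalPhysics.QuantumFieldTheory.Balaban1983to89
open Literature.MathematicalPhysics.QuantumFieldTheory.Balaban1983to89.B4Reflection242
open Literature.MathematicalPhysics.QuantumFieldTheory.Balaban1983to89.B4BoxCov237
open Literature.MathematicalPhysics.QuantumFieldTheory.Balaban1983to89.B4Lower18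
open Literature.MathematicalPhysics.QuantumFieldTheory.Balaban1983to89.Beta.CombesThomasForm (lap lap_apply lap_mulVec lap_form)

/-! ### §1 The abstract commutator bound for `lap c + Σ_b m_b 1_b ⊗ 1_b` -/

section Abstract

variable {ι : Type*} [Fintype ι] [DecidableEq ι] {β : Type*} [DecidableEq β]

/-- the commutator applied to a vector: `([diag(l),H]v)_j = Σ_k H_{jk}(l_j − l_k)v_k`. [folklore] -/
theorem comm_mulVec_apply (l : ι → ℝ) (H : Matrix ι ι ℝ) (v : ι → ℝ) (j : ι) :
    ((diagonal l * H - H * diagonal l) *ᵥ v) j = ∑ k, H j k * (l j - l k) * v k := by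
  simp only [mulVec, dotProduct]
  refine Finset.sum_congr rfl fun k _ => ?_
  rw [Matrix.sub_apply, diagonal_mul, mul_diagonal]; ring

/-- the Laplacian part of the commutator, split by the Leibniz rule (2.3):
`Σ_k lap c_{jk}(l_j − l_k)v_k = −Σ_k c_{jk}(l_j − l_k)(v_k − v_j) − v_j·Σ_k c_{jk}(l_j − l_k)`. [cite: Balaban1983RegularityDecay, (2.3) p.575, mechanism] [folklore] -/
theorem lap_comm_split (c : ι → ι → ℝ) (l v : ι → ℝ) (j : ι) :
    ∑ k, lap c j k * (l j - l k) * v k =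
      -(∑ k, c j k * (l j - l k) * (v k - v j)) - v j * ∑ k, c j k * (l j - l k) := by
  have h1 : ∑ k, lap c j k * (l j - l k) * v k = -∑ k, c j k * (l j - l k) * v k := by
    rw [← Finset.sum_neg_distrib]
    refine Finset.sum_congr rfl fun k _ => ?_
    rw [lap_apply]
    by_cases hjk : j = k
    · subst hjk; simp
    · rw [if_neg hjk]; ring
  have h2 : ∑ k, c j k * (l j - l k) * v k = ∑ k, c j k * (l j - l k) * (v k - v j) + v j * ∑ k, c j k * (l j - l k) := by
    rw [Finset.mul_sum, ← Finset.sum_add_distrib]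
    exact Finset.sum_congr rfl fun k _ => by ring
  rw [h1, h2]; ring

omit [DecidableEq ι] in
/-- the block part of the commutator collapses to the block of `j`:
`Σ_k (Σ_b m_b 1_b(j)1_b(k))(l_j − l_k)v_k = Σ_k [blk k = blk j]·m_{blk j}·(l_j − l_k)v_k`. [folklore] -/
theorem block_comm_eq [Fintype β] (blk : ι → β) (m : β → ℝ) (l v : ι → ℝ) (j : ι) :
    ∑ k, (∑ b, m b * ((if blk j = b then (1 : ℝ) else 0) * (if blk k = b then (1 : ℝ) else 0))) * (l j - l k) * v k =
      ∑ k, (if blk k = blk j then m (blk j) else 0) * (l j - l k) * v k :=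
  Finset.sum_congr rfl fun k _ => by rw [sum_ind_mul_ind]

omit [DecidableEq ι] in
/-- **THE GRADIENT TERM IS CARRIED BY THE DIRICHLET FORM** (weighted Cauchy–Schwarz):
`(Σ_k c_{jk}(l_j−l_k)(v_k−v_j))² ≤ (Σ_k c_{jk}(l_j−l_k)²)·(Σ_k c_{jk}(v_k−v_j)²)` for `c ≥ 0`. [folklore] -/
theorem grad_term_sq_le (c : ι → ι → ℝ) (hc0 : ∀ j k, 0 ≤ c j k) (l v : ι → ℝ) (j : ι) :
    (∑ k, c j k * (l j - l k) * (v k - v j)) ^ 2 ≤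
      (∑ k, c j k * (l j - l k) ^ 2) * ∑ k, c j k * (v k - v j) ^ 2 := by
  have h1 : |∑ k, c j k * (l j - l k) * (v k - v j)| ≤ ∑ k, c j k * |l j - l k| * |v k - v j| :=
    (Finset.abs_sum_le_sum_abs _ _).trans (le_of_eq (Finset.sum_congr rfl fun k _ => by
      rw [abs_mul, abs_mul, abs_of_nonneg (hc0 j k)]))
  have h2 : (∑ k, c j k * |l j - l k| * |v k - v j|) ^ 2 ≤
      (∑ k, c j k * (l j - l k) ^ 2) * ∑ k, c j k * (v k - v j) ^ 2 :=
    Finset.sum_sq_le_sum_mul_sum_of_sq_le_mul _ (fun k _ => mul_nonneg (hc0 j k) (sq_nonneg _))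
      (fun k _ => mul_nonneg (hc0 j k) (sq_nonneg _)) (fun k _ => le_of_eq (by
        rw [mul_pow, mul_pow, sq_abs, sq_abs]; ring))
  have h0 : 0 ≤ ∑ k, c j k * |l j - l k| * |v k - v j| :=
    Finset.sum_nonneg fun k _ => mul_nonneg (mul_nonneg (hc0 j k) (abs_nonneg _)) (abs_nonneg _)
  calc (∑ k, c j k * (l j - l k) * (v k - v j)) ^ 2 = |∑ k, c j k * (l j - l k) * (v k - v j)| ^ 2 := (sq_abs _).symm
    _ ≤ (∑ k, c j k * |l j - l k| * |v k - v j|) ^ 2 := pow_le_pow_left₀ (abs_nonneg _) h1 2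
    _ ≤ _ := h2

/-- the Dirichlet double sum is twice the Laplacian form: `Σ_jΣ_k c_{jk}(v_k−v_j)² = 2⟨v, lap c v⟩`. [folklore] -/
theorem dirichlet_sum_eq (c : ι → ι → ℝ) (hc : ∀ j k, c j k = c k j) (v : ι → ℝ) :
    ∑ j, ∑ k, c j k * (v k - v j) ^ 2 = 2 * (v ⬝ᵥ (lap c) *ᵥ v) := by
  rw [lap_form c hc v]
  have : ∑ j, ∑ k, c j k * (v k - v j) ^ 2 = ∑ j, ∑ k, c j k * (v j - v k) ^ 2 :=
    Finset.sum_congr rfl fun j _ => Finset.sum_congr rfl fun k _ => by ring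
  rw [this]; ring

/-- the form of `lap c + Σ_b m_b 1_b ⊗ 1_b` dominates the Laplacian form (the block part is a sum of squares). [folklore] -/
theorem lap_form_le_form [Fintype β] (c : ι → ι → ℝ) (blk : ι → β) (m : β → ℝ) (hm : ∀ b, 0 ≤ m b) (H : Matrix ι ι ℝ)
    (hH : ∀ j k, H j k = lap c j k + ∑ b, m b * ((if blk j = b then (1 : ℝ) else 0) * (if blk k = b then (1 : ℝ) else 0)))
    (v : ι → ℝ) : v ⬝ᵥ (lap c) *ᵥ v ≤ v ⬝ᵥ H *ᵥ v := by
  have hsplit : v ⬝ᵥ H *ᵥ v = v ⬝ᵥ (lap c) *ᵥ v +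
      ∑ j, v j * ∑ k, (∑ b, m b * ((if blk j = b then (1 : ℝ) else 0) * (if blk k = b then (1 : ℝ) else 0))) * v k := by
    simp only [dotProduct, mulVec, hH, add_mul, Finset.sum_add_distrib, mul_add]
  rw [hsplit, Beta.BlockPoincare.quadForm_rankOne_sum]
  have : 0 ≤ ∑ b, m b * (∑ i, (if blk i = b then (1 : ℝ) else 0) * v i) ^ 2 :=
    Finset.sum_nonneg fun b _ => mul_nonneg (hm b) (sq_nonneg _)
  linarith

omit [DecidableEq ι] in
/-- **THE BLOCK TERM** (Cauchy–Schwarz on the block): with `|l_j − l_k| ≤ δ` inside blocks and `m ≥ 0`,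
`(Σ_k [blk k = blk j]·m_{blk j}(l_j − l_k)v_k)² ≤ δ²·m_{blk j}²·N_j·Σ_k [blk k = blk j]v_k²`, `N_j` = the size of the block of `j`. [folklore] -/
theorem block_term_sq_le (blk : ι → β) (m : β → ℝ) (l v : ι → ℝ) {δ : ℝ} (hδ0 : 0 ≤ δ)
    (hδ : ∀ j k, blk j = blk k → |l j - l k| ≤ δ) (j : ι) :
    (∑ k, (if blk k = blk j then m (blk j) else 0) * (l j - l k) * v k) ^ 2 ≤
      δ ^ 2 * m (blk j) ^ 2 * ((univ.filter fun k => blk k = blk j).card : ℝ) *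
        ∑ k, (if blk k = blk j then v k ^ 2 else 0) := by
  have h1 : |∑ k, (if blk k = blk j then m (blk j) else 0) * (l j - l k) * v k| ≤
      ∑ k, (if blk k = blk j then (1 : ℝ) else 0) * (|m (blk j)| * δ * |v k|) := by
    refine (Finset.abs_sum_le_sum_abs _ _).trans (Finset.sum_le_sum fun k _ => ?_)
    by_cases hk : blk k = blk j
    · rw [if_pos hk, if_pos hk, one_mul, abs_mul, abs_mul]
      have := hδ j k hk.symm
      have h0 : 0 ≤ |m (blk j)| := abs_nonneg _
      have h0' : 0 ≤ |v k| := abs_nonneg _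
      calc |m (blk j)| * |l j - l k| * |v k| ≤ |m (blk j)| * δ * |v k| := by gcongr
        _ = _ := rfl
    · rw [if_neg hk, if_neg hk]; simp
  have h2 : (∑ k, (if blk k = blk j then (1 : ℝ) else 0) * (|m (blk j)| * δ * |v k|)) ^ 2 ≤
      (∑ k, (if blk k = blk j then (1 : ℝ) else 0) ^ 2) * ∑ k, (|m (blk j)| * δ * |v k| * (if blk k = blk j then (1 : ℝ) else 0)) ^ 2 := by
    have := Finset.sum_mul_sq_le_sq_mul_sq (univ : Finset ι) (fun k => (if blk k = blk j then (1 : ℝ) else 0))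
      (fun k => |m (blk j)| * δ * |v k| * (if blk k = blk j then (1 : ℝ) else 0))
    refine le_trans (le_of_eq ?_) this
    congr 1
    exact Finset.sum_congr rfl fun k _ => by by_cases hk : blk k = blk j <;> simp [hk]
  have h3 : ∑ k, (if blk k = blk j then (1 : ℝ) else 0) ^ 2 = ((univ.filter fun k => blk k = blk j).card : ℝ) := by
    simp_rw [ite_pow, one_pow, zero_pow two_ne_zero]
    rw [Finset.sum_boole]
  have h4 : ∑ k, (|m (blk j)| * δ * |v k| * (if blk k = blk j then (1 : ℝ) else 0)) ^ 2 =
      δ ^ 2 * m (blk j) ^ 2 * ∑ k, (if blk k = blk j then v k ^ 2 else 0) := by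
    rw [Finset.mul_sum]
    refine Finset.sum_congr rfl fun k _ => ?_
    by_cases hk : blk k = blk j
    · rw [if_pos hk, if_pos hk, mul_one, mul_pow, mul_pow, sq_abs, sq_abs]; ring
    · rw [if_neg hk, if_neg hk]; simp
  have h0 : 0 ≤ ∑ k, (if blk k = blk j then (1 : ℝ) else 0) * (|m (blk j)| * δ * |v k|) :=
    Finset.sum_nonneg fun k _ => by positivity
  calc (∑ k, (if blk k = blk j then m (blk j) else 0) * (l j - l k) * v k) ^ 2
      = |∑ k, (if blk k = blk j then m (blk j) else 0) * (l j - l k) * v k| ^ 2 := (sq_abs _).symm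
    _ ≤ (∑ k, (if blk k = blk j then (1 : ℝ) else 0) * (|m (blk j)| * δ * |v k|)) ^ 2 := pow_le_pow_left₀ (abs_nonneg _) h1 2
    _ ≤ _ := h2
    _ = _ := by rw [h3, h4]; ring

omit [DecidableEq ι] in
/-- summing the block terms: `Σ_j m_{blk j}²·N_j·Σ_{k ∈ blk j} v_k² = Σ_k (m_{blk k}N_k)²·v_k² ≤ a′²‖v‖²` when `m_{blk k}·N_k ≤ a′`. [folklore] -/
theorem sum_block_term_le (blk : ι → β) (m : β → ℝ) (hm : ∀ b, 0 ≤ m b) (v : ι → ℝ) {a' : ℝ}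
    (ha' : ∀ k, m (blk k) * ((univ.filter fun j => blk j = blk k).card : ℝ) ≤ a') :
    ∑ j, m (blk j) ^ 2 * ((univ.filter fun k => blk k = blk j).card : ℝ) * ∑ k, (if blk k = blk j then v k ^ 2 else 0)
      ≤ a' ^ 2 * (v ⬝ᵥ v) := by
  set N : β → ℝ := fun b => ((univ.filter fun k => blk k = b).card : ℝ) with hN
  have hNsum : ∀ b, N b = ∑ j, (if blk j = b then (1 : ℝ) else 0) := fun b => by
    rw [hN]; simp only [Finset.sum_boole]
  have h1 : ∑ j, m (blk j) ^ 2 * N (blk j) * ∑ k, (if blk k = blk j then v k ^ 2 else 0)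
      = ∑ k, v k ^ 2 * ∑ j, (if blk j = blk k then m (blk j) ^ 2 * N (blk j) else 0) := by
    simp_rw [Finset.mul_sum]
    rw [Finset.sum_comm]
    refine Finset.sum_congr rfl fun k _ => Finset.sum_congr rfl fun j _ => ?_
    by_cases h : blk k = blk j
    · rw [if_pos h, if_pos h.symm]; ring
    · rw [if_neg h, if_neg (Ne.symm h)]; ring
  have h2 : ∀ k, ∑ j, (if blk j = blk k then m (blk j) ^ 2 * N (blk j) else 0) = (m (blk k) * N (blk k)) ^ 2 := by
    intro k
    have : ∑ j, (if blk j = blk k then m (blk j) ^ 2 * N (blk j) else 0)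
        = ∑ j, (if blk j = blk k then (1 : ℝ) else 0) * (m (blk k) ^ 2 * N (blk k)) :=
      Finset.sum_congr rfl fun j _ => by
        by_cases h : blk j = blk k
        · rw [if_pos h, if_pos h, h, one_mul]
        · rw [if_neg h, if_neg h, zero_mul]
    rw [this, ← Finset.sum_mul, ← hNsum]; ring
  rw [h1, dotProduct, Finset.mul_sum]
  refine Finset.sum_le_sum fun k _ => ?_
  rw [h2 k]
  have hb : m (blk k) * N (blk k) ≤ a' := ha' k
  have hb0 : 0 ≤ m (blk k) * N (blk k) := mul_nonneg (hm _) (Nat.cast_nonneg _)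
  have : (m (blk k) * N (blk k)) ^ 2 ≤ a' ^ 2 := pow_le_pow_left₀ hb0 hb 2
  nlinarith [sq_nonneg (v k)]

/-- **B4 LEMMA 2.1's L²-CONTENT, ABSTRACT FORM**: for `H_{jk} = lap c_{jk} + Σ_b m_b 1_b(j)1_b(k)` (symmetric `c ≥ 0`, `m ≥ 0`,
`m_{blk k}·|block of k| ≤ a′`) and a cut-off `l` with `Σ_k c_{jk}(l_j − l_k)² ≤ A`, `|Σ_k c_{jk}(l_j − l_k)| ≤ B`, `|l_j − l_k| ≤ δ` (`δ ≥ 0`)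
inside blocks: `‖[diag(l),H]v‖² ≤ 6A·⟨v,Hv⟩ + 3(B² + a′²δ²)‖v‖²` for every `v`. [cite: Balaban1983RegularityDecay, (2.3) p.575 + Lemma 2.1 (2.15) p.577, mechanism at A = 0] [folklore] -/
theorem comm_mulVec_sq_le_lap_add_blocks [Fintype β] (c : ι → ι → ℝ) (hc : ∀ j k, c j k = c k j) (hc0 : ∀ j k, 0 ≤ c j k)
    (blk : ι → β) (m : β → ℝ) (hm : ∀ b, 0 ≤ m b) (H : Matrix ι ι ℝ)
    (hH : ∀ j k, H j k = lap c j k + ∑ b, m b * ((if blk j = b then (1 : ℝ) else 0) * (if blk k = b then (1 : ℝ) else 0)))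
    (l : ι → ℝ) {A B δ a' : ℝ} (hA0 : 0 ≤ A) (hA : ∀ j, ∑ k, c j k * (l j - l k) ^ 2 ≤ A)
    (hB : ∀ j, |∑ k, c j k * (l j - l k)| ≤ B) (hδ0 : 0 ≤ δ) (hδ : ∀ j k, blk j = blk k → |l j - l k| ≤ δ)
    (ha' : ∀ k, m (blk k) * ((univ.filter fun j => blk j = blk k).card : ℝ) ≤ a') (v : ι → ℝ) :
    (diagonal l * H - H * diagonal l) *ᵥ v ⬝ᵥ (diagonal l * H - H * diagonal l) *ᵥ v ≤
      6 * A * (v ⬝ᵥ H *ᵥ v) + 3 * (B ^ 2 + a' ^ 2 * δ ^ 2) * (v ⬝ᵥ v) := by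
  -- the three terms
  set X : ι → ℝ := fun j => ∑ k, c j k * (l j - l k) * (v k - v j) with hX
  set Y : ι → ℝ := fun j => v j * ∑ k, c j k * (l j - l k) with hY
  set Z : ι → ℝ := fun j => ∑ k, (if blk k = blk j then m (blk j) else 0) * (l j - l k) * v k with hZ
  have hE : ∀ j, ((diagonal l * H - H * diagonal l) *ᵥ v) j = -X j + -Y j + Z j := by
    intro j
    rw [comm_mulVec_apply]
    have : ∑ k, H j k * (l j - l k) * v k = ∑ k, lap c j k * (l j - l k) * v k +
        ∑ k, (∑ b, m b * ((if blk j = b then (1 : ℝ) else 0) * (if blk k = b then (1 : ℝ) else 0))) * (l j - l k) * v k := by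
      rw [← Finset.sum_add_distrib]
      exact Finset.sum_congr rfl fun k _ => by rw [hH j k]; ring
    rw [this, lap_comm_split, block_comm_eq]
    simp only [hX, hY, hZ]; ring
  -- squares
  have hX2 : ∑ j, X j ^ 2 ≤ A * (2 * (v ⬝ᵥ H *ᵥ v)) := by
    have h1 : ∀ j, X j ^ 2 ≤ A * ∑ k, c j k * (v k - v j) ^ 2 := fun j =>
      (grad_term_sq_le c hc0 l v j).trans (mul_le_mul_of_nonneg_right (hA j)
        (Finset.sum_nonneg fun k _ => mul_nonneg (hc0 j k) (sq_nonneg _)))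
    refine (Finset.sum_le_sum fun j _ => h1 j).trans ?_
    rw [← Finset.mul_sum, dirichlet_sum_eq c hc v]
    refine mul_le_mul_of_nonneg_left ?_ hA0
    linarith [lap_form_le_form c blk m hm H hH v]
  have hY2 : ∑ j, Y j ^ 2 ≤ B ^ 2 * (v ⬝ᵥ v) := by
    rw [dotProduct, Finset.mul_sum]
    refine Finset.sum_le_sum fun j _ => ?_
    rw [hY, mul_pow]
    have h1 : (∑ k, c j k * (l j - l k)) ^ 2 ≤ B ^ 2 := by
      have := hB j
      have hB0 : 0 ≤ B := (abs_nonneg _).trans this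
      nlinarith [abs_nonneg (∑ k, c j k * (l j - l k)), sq_abs (∑ k, c j k * (l j - l k))]
    nlinarith [sq_nonneg (v j)]
  have hZ2 : ∑ j, Z j ^ 2 ≤ a' ^ 2 * δ ^ 2 * (v ⬝ᵥ v) := by
    have h1 : ∀ j, Z j ^ 2 ≤ δ ^ 2 * (m (blk j) ^ 2 * ((univ.filter fun k => blk k = blk j).card : ℝ) *
        ∑ k, (if blk k = blk j then v k ^ 2 else 0)) := fun j =>
      (block_term_sq_le blk m l v hδ0 hδ j).trans (le_of_eq (by ring))
    refine (Finset.sum_le_sum fun j _ => h1 j).trans ?_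
    rw [← Finset.mul_sum]
    have := sum_block_term_le blk m hm v ha'
    nlinarith [sq_nonneg δ]
  -- assemble
  calc (diagonal l * H - H * diagonal l) *ᵥ v ⬝ᵥ (diagonal l * H - H * diagonal l) *ᵥ v
      = ∑ j, (-X j + -Y j + Z j) ^ 2 := by
        rw [dotProduct]; exact Finset.sum_congr rfl fun j _ => by rw [hE j, sq]
    _ ≤ ∑ j, 3 * ((-X j) ^ 2 + (-Y j) ^ 2 + Z j ^ 2) := Finset.sum_le_sum fun j _ => by
        -- `(x+y+z)² ≤ 3(x²+y²+z²)` (the tree's `MatomakiRadziwillL14.sq_add_three_le`, not imported for one line)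
        nlinarith [sq_nonneg (-X j - -Y j), sq_nonneg (-Y j - Z j), sq_nonneg (-X j - Z j)]
    _ = 3 * (∑ j, X j ^ 2 + ∑ j, Y j ^ 2 + ∑ j, Z j ^ 2) := by
        rw [← Finset.mul_sum, Finset.sum_add_distrib, Finset.sum_add_distrib]
        congr 1; congr 1; congr 1 <;> exact Finset.sum_congr rfl fun j _ => by ring
    _ ≤ 3 * (A * (2 * (v ⬝ᵥ H *ᵥ v)) + B ^ 2 * (v ⬝ᵥ v) + a' ^ 2 * δ ^ 2 * (v ⬝ᵥ v)) := by
        gcongr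
    _ = 6 * A * (v ⬝ᵥ H *ᵥ v) + 3 * (B ^ 2 + a' ^ 2 * δ ^ 2) * (v ⬝ᵥ v) := by ring

end Abstract

/-! ### §2 The instance: Bałaban's A = 0 operator `fineOpR n a 0 R` -/

section FineOp

variable {d : ℕ}

/-- **(H-comm) FOR BAŁABAN's `A = 0` OPERATOR, MESH-FREE.**  For `n ≥ 1` (`η = 1∕n`), `R` a finite union of `n`-blocks, `a ≥ 0` and a
cut-off `l : R → ℝ` with `|l_x − l_y| ≤ ℓ₁` across nearest-neighbour bonds of `R`, `|Σ_{y ∼ x, y ∈ R}(l_x − l_y)| ≤ ℓ₂` at every site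
(the Neumann-compatible second difference) and `|l_x − l_y| ≤ ℓ₃` inside `n`-blocks:
`‖[diag(l), fineOpR n a 0 R]v‖² ≤ 12(d+1)n²ℓ₁²·⟨v, fineOpR v⟩ + 3((n²ℓ₂)² + a²ℓ₃²)·‖v‖²`.  With `ℓ₁ = c∕(Mn)`, `ℓ₂ = c′∕(Mn)²`,
`ℓ₃ = c″∕M` (a cut-off varying on the scale of `M` blocks) no power of `n` survives — Lemma 2.1's «O(1) uniformly in η» at A = 0.
[cite: Balaban1983RegularityDecay, (2.3) p.575 + Lemma 2.1 (2.15) p.577, case A = 0] [folklore] -/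
theorem comm_mulVec_sq_le_fineOpR {n : ℕ} (hn : 1 ≤ n) {R : Finset (Fin (d + 1) → ℤ)} (hR : IsBlockUnion n R) {a : ℝ}
    (ha : 0 ≤ a) (l : ↥R → ℝ) {ℓ₁ ℓ₂ ℓ₃ : ℝ} (hℓ₁ : 0 ≤ ℓ₁) (hℓ₃ : 0 ≤ ℓ₃)
    (hbond : ∀ x y : ↥R, y.1 ∈ nbrs x.1 → |l x - l y| ≤ ℓ₁)
    (hlap : ∀ x : ↥R, |∑ y ∈ univ.filter (fun y : ↥R => y.1 ∈ nbrs x.1), (l x - l y)| ≤ ℓ₂)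
    (hblock : ∀ x y : ↥R, blk n x.1 = blk n y.1 → |l x - l y| ≤ ℓ₃) (v : ↥R → ℝ) :
    (diagonal l * fineOpR n a 0 R - fineOpR n a 0 R * diagonal l) *ᵥ v ⬝ᵥ
        (diagonal l * fineOpR n a 0 R - fineOpR n a 0 R * diagonal l) *ᵥ v ≤
      12 * ((d : ℝ) + 1) * (n : ℝ) ^ 2 * ℓ₁ ^ 2 * (v ⬝ᵥ fineOpR n a 0 R *ᵥ v) +
        3 * (((n : ℝ) ^ 2 * ℓ₂) ^ 2 + a ^ 2 * ℓ₃ ^ 2) * (v ⬝ᵥ v) := by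
  classical
  have hn0 : (0 : ℝ) < n := by exact_mod_cast hn
  have hcard : ∀ b : ↥(R.image (blk n)),
      ((Finset.univ.filter fun i => rblk n R i = b).card : ℝ) = (n : ℝ) ^ (d + 1) := by
    intro b
    rw [card_filter_rblk hn hR b]
    push_cast
    rfl
  -- (A): the weighted Lipschitz² per row
  have hA : ∀ x : ↥R, ∑ y, adjC n R x y * (l x - l y) ^ 2 ≤ 2 * ((d : ℝ) + 1) * (n : ℝ) ^ 2 * ℓ₁ ^ 2 := by
    intro x
    have h1 : ∀ y, adjC n R x y * (l x - l y) ^ 2 ≤ (if adjC n R x y ≠ 0 then (1 : ℝ) else 0) * ((n : ℝ) ^ 2 * ℓ₁ ^ 2) := by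
      intro y
      by_cases hy : y.1 ∈ nbrs x.1
      · have hne : adjC n R x y ≠ 0 := by simp [adjC, hy, hn0.ne']
        rw [if_pos hne, one_mul]
        simp only [adjC, hy, if_true]
        have := hbond x y hy
        have h2 : (l x - l y) ^ 2 ≤ ℓ₁ ^ 2 := by nlinarith [abs_nonneg (l x - l y), sq_abs (l x - l y)]
        exact mul_le_mul_of_nonneg_left h2 (by positivity)
      · simp [adjC, hy]
    refine (Finset.sum_le_sum fun y _ => h1 y).trans ?_
    rw [← Finset.sum_mul, Finset.sum_boole]
    have := card_filter_adjC_ne_zero_le n R x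
    have h0 : 0 ≤ (n : ℝ) ^ 2 * ℓ₁ ^ 2 := by positivity
    nlinarith
  -- (B): the operator applied to the cut-off
  have hB : ∀ x : ↥R, |∑ y, adjC n R x y * (l x - l y)| ≤ (n : ℝ) ^ 2 * ℓ₂ := by
    intro x
    have h1 : ∑ y, adjC n R x y * (l x - l y) = (n : ℝ) ^ 2 * ∑ y ∈ univ.filter (fun y : ↥R => y.1 ∈ nbrs x.1), (l x - l y) := by
      rw [Finset.mul_sum, Finset.sum_filter]
      refine Finset.sum_congr rfl fun y _ => ?_
      simp only [adjC]; split_ifs <;> simp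
    rw [h1, abs_mul, abs_of_nonneg (by positivity : (0 : ℝ) ≤ (n : ℝ) ^ 2)]
    exact mul_le_mul_of_nonneg_left (hlap x) (by positivity)
  -- (δ), (a′)
  have hδ : ∀ x y : ↥R, rblk n R x = rblk n R y → |l x - l y| ≤ ℓ₃ := fun x y hxy =>
    hblock x y (congrArg Subtype.val hxy)
  have ha' : ∀ y : ↥R, a / ((Finset.univ.filter fun i => rblk n R i = rblk n R y).card : ℝ) *
      ((Finset.univ.filter fun j => rblk n R j = rblk n R y).card : ℝ) ≤ a := by
    intro y
    rw [hcard, div_mul_cancel₀ a (by positivity)]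
  have h := comm_mulVec_sq_le_lap_add_blocks (adjC n R) (adjC_symm n R) (adjC_nonneg n R) (rblk n R)
    (fun b => a / ((Finset.univ.filter fun i => rblk n R i = b).card : ℝ))
    (fun b => div_nonneg ha (Nat.cast_nonneg _)) (fineOpR n a 0 R) (fineOpR_zero_eq hn hR a) l
    (A := 2 * ((d : ℝ) + 1) * (n : ℝ) ^ 2 * ℓ₁ ^ 2) (by positivity) hA hB hℓ₃ hδ ha' v
  refine h.trans (le_of_eq ?_)
  ring

end FineOp

end Summit.QuantumFields.BalabanUV.T4Continuum.NE7K1LinWalkCommutator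

end
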